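import Literature.AnabelianGeometry.EtaleTheta.KummerClass
import Mathlib.RepresentationTheory.Homological.GroupCohomology.Functoriality

/-!
# Functoriality of Kummer classes under equivariant co-morphisms

Source: LANA Project interim report [LANA2026Report], §6.1, pp. 31–32. "Such Kummer maps are
functorial in the following sense. First, a morphism (or, say, an *equivariant co-morphism*)
`(φ_*, φ^*) : (G_Y, M_Y) → (G_X, M_X)` of pairs as above consists of a continuous homomorphism
`φ_* : G_Y → G_X` and a continuous monoid homomorphism `φ^* : M_X → M_Y` such that
`φ^*(φ_*(γ) · m) = γ · φ^*(m)` for all `γ ∈ G_Y`, `m ∈ M_X`, and such that each `H` in the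
`G_X`-system contains `φ_*(H')` for some `H'` in the `G_Y`-system. Since `φ^*` is a monoid
homomorphism it restricts to `λ_n : M_X^gp[n] → M_Y^gp[n]`, and hence induces a continuous
`G_Y`-equivariant map `λ : Λ(M_X) → Λ(M_Y)`, where `G_Y` acts on `Λ(M_X)` through `φ_*`. This
induces a map `lim_H H¹(H, Λ(M_X)) → lim_{H'} H¹(H', Λ(M_Y))`. It is easy to see that this map
is compatible with the Kummer maps in the sense that the following square commutes:
`κ_Y ∘ φ^* = (induced map) ∘ κ_X`." (p. 32)

## What is here (proved)

* `CoMorphism` : the data `(φ_*, φ^*)` with the equivariance identity (discrete version; the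
  condition on the systems of subgroups is a hypothesis `φ_*(H') ≤ H` of the statements below);
* `CoMorphism.cyclotomeHom` : `λ` as a morphism `res φ_* Λ(A_X) ⟶ Λ(A_Y)` in `Rep ℤ H'`;
* `CoMorphism.map_kummerClassOfRootSystem` / `map_kummerClass` : the commuting square at a
  fixed level `(H, H')`, for Mathlib's `groupCohomology.map` on `H¹`.

The passage to the colimit over the systems of subgroups is bookkeeping on top of this
level-wise statement and is deferred to `KummerMap.lean`.
-/

namespace Literature.AnabelianGeometry.EtaleTheta

open groupCohomology CategoryTheory

/-- An **equivariant co-morphism** `(φ_*, φ^*) : (G_Y, A_Y) → (G_X, A_X)` of groups acting on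
commutative groups [cite: LANA2026Report, §6.1 pp.31–32]: a group homomorphism
`φ_* : G_Y → G_X` and a homomorphism `φ^* : A_X → A_Y` in the opposite direction with
`φ^*(φ_*(γ) • m) = γ • φ^*(m)`. -/
structure CoMorphism (GX AX GY AY : Type*) [Group GX] [CommGroup AX] [MulDistribMulAction GX AX]
    [Group GY] [CommGroup AY] [MulDistribMulAction GY AY] where
  /-- `φ_* : G_Y → G_X` -/
  groupHom : GY →* GX
  /-- `φ^* : A_X → A_Y` -/
  map : AX →* AY
  /-- the equivariance `φ^*(φ_*(γ) • m) = γ • φ^*(m)` -/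
  map_smul : ∀ (γ : GY) (m : AX), map (groupHom γ • m) = γ • map m

namespace CoMorphism

section General

variable {GX AX GY AY : Type*} [Group GX] [CommGroup AX] [MulDistribMulAction GX AX]
  [Group GY] [CommGroup AY] [MulDistribMulAction GY AY] (c : CoMorphism GX AX GY AY)

/-- `λ : Λ(A_X) → Λ(A_Y)` is `G_Y`-equivariant when `G_Y` acts on `Λ(A_X)` through `φ_*`.
[cite: LANA2026Report, §6.1 p.32] -/
theorem cyclotome_map_smul (γ : GY) (ζ : cyclotome AX) :
    cyclotome.map c.map (c.groupHom γ • ζ) = γ • cyclotome.map c.map ζ :=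
  Subtype.ext (funext fun _ => c.map_smul γ _)

/-- `φ^*` carries `H`-invariants to `H'`-invariants whenever `φ_*(H') ≤ H`.
[cite: LANA2026Report, §6.1 p.32] -/
theorem map_mem_fixedPoints {H : Subgroup GX} {H' : Subgroup GY} (hH : H'.map c.groupHom ≤ H)
    {a : AX} (ha : a ∈ MulAction.fixedPoints H AX) :
    c.map a ∈ MulAction.fixedPoints H' AY := by
  intro γ
  change (γ : GY) • c.map a = c.map a
  rw [← c.map_smul]
  congr 1
  exact ha ⟨c.groupHom γ, hH ⟨γ, γ.2, rfl⟩⟩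

/-- The restriction `φ_*| : H' → H` of `φ_*` to members of the two systems of subgroups with
`φ_*(H') ≤ H`. [cite: LANA2026Report, §6.1 p.32] -/
def groupHomRestrict {H : Subgroup GX} {H' : Subgroup GY} (hH : H'.map c.groupHom ≤ H) :
    H' →* H :=
  (c.groupHom.restrict H').codRestrict H fun γ => hH ⟨γ, γ.2, rfl⟩

/-- Values of the restricted homomorphism. [cite: LANA2026Report, §6.1 p.32] -/
@[simp] theorem coe_groupHomRestrict_apply {H : Subgroup GX} {H' : Subgroup GY}
    (hH : H'.map c.groupHom ≤ H) (γ : H') :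
    ((c.groupHomRestrict hH γ : H) : GX) = c.groupHom γ := rfl

/-- Cochain-level functoriality: the Kummer cocycle of the image root system `φ^* ∘ x` at `γ`
is `λ` of the Kummer cocycle of `x` at `φ_*(γ)`. [cite: LANA2026Report, §6.1 p.32] -/
theorem kummerCocycle_map {H : Subgroup GX} {H' : Subgroup GY} (hH : H'.map c.groupHom ≤ H)
    {a : AX} (x : RootSystem a) (ha : a ∈ MulAction.fixedPoints H AX) (γ : H') :
    (x.map c.map).kummerCocycle (c.map_mem_fixedPoints hH ha) γ =
      cyclotome.map c.map (x.kummerCocycle ha (c.groupHomRestrict hH γ)) := by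
  refine Subtype.ext (funext fun n => ?_)
  change ((γ : GY) • c.map (x.root n)) / c.map (x.root n) =
    c.map ((c.groupHom γ • x.root n) / x.root n)
  rw [map_div, c.map_smul]

end General

section Cohomology

variable {GX AX GY AY : Type} [Group GX] [CommGroup AX] [MulDistribMulAction GX AX]
  [Group GY] [CommGroup AY] [MulDistribMulAction GY AY] (c : CoMorphism GX AX GY AY)
  {H : Subgroup GX} {H' : Subgroup GY} (hH : H'.map c.groupHom ≤ H)

/-- `λ : Λ(A_X) → Λ(A_Y)` as a morphism `res φ_*| Λ(A_X) ⟶ Λ(A_Y)` of `ℤ`-linear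
`H'`-representations (Mathlib `Rep`). [cite: LANA2026Report, §6.1 p.32] -/
noncomputable def cyclotomeHom :
    Rep.res (c.groupHomRestrict hH) (cyclotomeRep (A := AX) H) ⟶ cyclotomeRep (A := AY) H' :=
  Rep.ofHom
    { toLinearMap := (MonoidHom.toAdditive (cyclotome.map c.map)).toIntLinearMap
      isIntertwining' := fun γ =>
        LinearMap.ext fun v => c.cyclotome_map_smul γ (Additive.toMul (α := cyclotome AX) v) }

/-- `cyclotomeHom` on elements. [cite: LANA2026Report, §6.1 p.32] -/
@[simp] theorem cyclotomeHom_hom_apply (v : Additive (cyclotome AX)) :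
    (c.cyclotomeHom hH).hom v = Additive.ofMul (cyclotome.map c.map v.toMul) := rfl

/-- The map `H¹(H, Λ(A_X)) → H¹(H', Λ(A_Y))` induced by `(φ_*|, λ)` (Mathlib
`groupCohomology.map` in degree `1`). [cite: LANA2026Report, §6.1 p.32] -/
noncomputable abbrev H1Map : H1 (cyclotomeRep (A := AX) H) ⟶ H1 (cyclotomeRep (A := AY) H') :=
  groupCohomology.map (c.groupHomRestrict hH) (c.cyclotomeHom hH) 1

/-- **The functoriality square at level `(H, H')`, root-system form**: the induced map on `H¹`
sends the Kummer class of `a` (computed with `x`) to the Kummer class of `φ^*(a)` (computed with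
`φ^* ∘ x`). [cite: LANA2026Report, §6.1 p.32] -/
theorem map_kummerClassOfRootSystem {a : AX} (x : RootSystem a)
    (ha : a ∈ MulAction.fixedPoints H AX) :
    c.H1Map hH (kummerClassOfRootSystem H x ha) =
      kummerClassOfRootSystem H' (x.map c.map) (c.map_mem_fixedPoints hH ha) := by
  rw [kummerClassOfRootSystem, kummerClassOfRootSystem, H1Map, H1π_comp_map_apply]
  congr 1
  refine cocycles₁_ext fun γ => ?_
  rw [coe_mapCocycles₁]
  change (c.cyclotomeHom hH).hom (kummerCocycles₁ H x ha (c.groupHomRestrict hH γ)) =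
    Additive.ofMul ((x.map c.map).kummerCocycle (c.map_mem_fixedPoints hH ha) γ)
  rw [c.kummerCocycle_map hH x ha γ]
  rfl

/-- `φ^*` restricted to invariants: `A_X^H → A_Y^{H'}`. [cite: LANA2026Report, §6.1 p.32] -/
def mapInvariants : invariants (A := AX) H →* invariants (A := AY) H' :=
  (c.map.restrict (invariants (A := AX) H)).codRestrict _ fun a => c.map_mem_fixedPoints hH a.2

/-- Values of `mapInvariants`. [cite: LANA2026Report, §6.1 p.32] -/
@[simp] theorem coe_mapInvariants_apply (a : invariants (A := AX) H) :
    ((c.mapInvariants hH a : invariants (A := AY) H') : AY) = c.map a := rfl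

variable [RootableBy AX ℕ] [RootableBy AY ℕ]

/-- **The functoriality square at level `(H, H')`** [cite: LANA2026Report, §6.1 p.32]:
`H1Map ∘ κ_X = κ_Y ∘ φ^*` on `H`-invariants of rootable groups. -/
theorem map_kummerClass (a : invariants (A := AX) H) :
    c.H1Map hH (kummerClass H a) = kummerClass H' (c.mapInvariants hH a) := by
  rw [kummerClass, c.map_kummerClassOfRootSystem hH]
  exact (kummerClass_eq_of_rootSystem H' (c.mapInvariants hH a)
    ((RootSystem.ofRootableBy (a : AX)).map c.map)).symm

/-- The same square for the bundled homomorphisms `kummerMapFixed`.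
[cite: LANA2026Report, §6.1 p.32] -/
theorem H1Map_comp_kummerMapFixed :
    (c.H1Map hH).hom.toAddMonoidHom.comp (kummerMapFixed H) =
      (kummerMapFixed H').comp (MonoidHom.toAdditive (c.mapInvariants hH)) := by
  ext a
  exact c.map_kummerClass hH a

end Cohomology

end CoMorphism

end Literature.AnabelianGeometry.EtaleTheta
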